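import Literature.AlgebraicTopology.SingularHomology.TransverseDiscFunctional
import HarnessLib

/-!
# The transverse disc functional on a class crossing the stratum with arbitrary local degrees

Topic `Literature/AlgebraicTopology/SingularHomology`, a sequel to `…TransverseDiscFunctional` (a
brick for the proof of the named fact
`Literature.Geometry.Symplectic.jSphere_wedgeCount_factorsThroughHomology`: the intersection count of
a `J`-holomorphic sphere with a compact `J`-holomorphic curve, where the crossings need not be
transverse and the local index is the order of vanishing).  Everything here is **proved**; no
definition, no named fact.

J. Milnor, *Lectures on the h-cobordism theorem* (1965), proof of Lemma 6.3 (PDF p. 37):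
`H_r(M) → H_r(M, M - M ∩ M') ≅ Σᵢ H_r(Uᵢ, Uᵢ - pᵢ) → H_r(E, E₀)`, *"from which it follows that
`g([M]) = M' · M`"* — the value of the functional on the class of a manifold meeting the stratum
in finitely many points is the sum of the LOCAL intersection numbers.  The tree's
`TransverseDiscDatum.functional_ofAbsolute_map_eq_sum` proves this when every crossing is
transverse (normal coordinate with invertible derivative, local number `sign det`).  A. Hatcher,
*Algebraic Topology* (2002), Prop. 2.30 and §3.3 p. 233, phrase the local contribution for an
arbitrary isolated crossing as the LOCAL DEGREE `deg f|ₓ` of the normal coordinate read in a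
Euclidean model, `f⁎ : Hₖ(V | c) → Hₖ(ℝᵏ | 0)`, `g_c ↦ (deg) • g₀`; this file records that form:

* `TransverseDiscDatum.map_localClass_closedBall_eq_smul` — a germ `t : (V, V ∖ c) → (B̄, B̄ ∖ 0)`
  whose underlying map `f` has local degree `d` at `c` sends `g_c` to `d •` the model base class;
* `TransverseDiscDatum.map_ret_comp_xEquiv_localClass_smul` — the local piece at a crossing of
  local degree `d` is `d • w₀`;
* **`TransverseDiscDatum.functional_ofAbsolute_map_eq_sum_smul`** — for `φ : T → X` meeting `P` in
  finitely many points `vᵢ = φ(eᵢ cᵢ)` with Euclidean models `eᵢ : Vᵢ ≃ Uᵢ` on which the normal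
  coordinate `K ∘ φ ∘ eᵢ = fᵢ` has local degree `dᵢ` at `cᵢ`, and a class `σ ∈ Hₖ(T)` whose local
  pieces at the `vᵢ` are `aᵢ` times the transported local orientation classes,
  `Λ(j⁎ φ⁎ σ) = (Σᵢ aᵢ dᵢ) • w₀`.

The proofs are those of `…TransverseDiscFunctional` with the local degree theorem
`HomologicalOrientation.localDegree_of_hasFDerivAt` replaced by the hypothesis on `fᵢ`; the
local-degree hypotheses are quantified over the (irrelevant) continuity and `MapsTo` proofs so
that they can be discharged from any presentation of the germ.

## References

* J. Milnor, *Lectures on the h-cobordism theorem*, Princeton Mathematical Notes (1965), proof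
  of Lemma 6.3 (PDF p. 37). [MilnorHCobordism1965]
* A. Hatcher, *Algebraic Topology*, CUP 2002, §2.1, Thm. 2.20, Prop. 2.30, §3.3 pp. 231–236.
  [HatcherAT2002]
-/

noncomputable section

open CategoryTheory Set Function Metric Filter
open scoped Topology

universe u

namespace Literature.AlgebraicTopology.SingularHomology

namespace TransverseDiscDatum

variable {X : Type u} [TopologicalSpace X] {k : ℕ} (D : TransverseDiscDatum X k)

/-! ### The local degree of a germ into the model ball -/

/-- **A germ of local degree `d` into the closed ball.**  Let `t : V → B̄(0, r)` (`V ⊆ ℝᵏ` open)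
be continuous with underlying map `f : ℝᵏ → ℝᵏ`, `t v ≠ 0` for `v ≠ p`, and suppose `f` has
local degree `d` at `p`: `f⁎ g_p = d • g₀` in `Hₖ(ℝᵏ | 0)` (Hatcher 2002, §3.3 p. 233 and
Prop. 2.30, `deg f|ₓ`).  Then `t⁎` sends the local orientation class at `p` to `d` times the
model base class (the excision `Hₖ(B̄ | 0) ≅ Hₖ(ℝᵏ | 0)`).
[cite: HatcherAT2002, §3.3 p. 233 and Prop. 2.30] -/
theorem map_localClass_closedBall_eq_smul (g : HomologicalOrientation ℤ (EuclideanSpace ℝ (Fin k)) k)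
    {V : Set (EuclideanSpace ℝ (Fin k))} (hV : IsOpen V) {p : EuclideanSpace ℝ (Fin k)} (hp : p ∈ V)
    (t : C(↥V, ↥(closedBall (0 : EuclideanSpace ℝ (Fin k)) D.r)))
    (f : EuclideanSpace ℝ (Fin k) → EuclideanSpace ℝ (Fin k)) (hft : ∀ v : ↥V, ((t v : EuclideanSpace ℝ (Fin k))) = f v)
    (d : ℤ)
    (hdeg : ∀ (hfc : ContinuousOn f V)
      (hm : MapsTo (fun v : ↥V => f v) ({(⟨p, hp⟩ : ↥V)}ᶜ : Set ↥V) ({(0 : EuclideanSpace ℝ (Fin k))}ᶜ)),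
      relativeSingularHomology.map ℤ ℤ (⟨fun v : ↥V => f v, hfc.restrict⟩ : C(↥V, EuclideanSpace ℝ (Fin k)))
        hm k ((localHomology.openSubsetIso ℤ ℤ hV hp k).inv (g.localClass p)) = d • g.localClass 0)
    (ht : MapsTo t ({(⟨p, hp⟩ : ↥V)}ᶜ : Set ↥V) ({D.zero}ᶜ : Set _)) :
    relativeSingularHomology.map ℤ ℤ t ht k ((localHomology.openSubsetIso ℤ ℤ hV hp k).inv (g.localClass p)) =
      d • D.modelBaseClass g := by
  -- push both sides into `Hₖ(ℝᵏ | 0)` along the (injective) inclusion of the closed ball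
  set J := relativeSingularHomology.map ℤ ℤ (subsetIncl (closedBall (0 : EuclideanSpace ℝ (Fin k)) D.r))
    (localHomology.mapsTo_subsetIncl_compl (mem_closedBall_self D.r_pos.le)) k with hJ
  have hinj : Function.Injective J := (asIso J).toLinearEquiv.injective
  apply hinj
  have hfc : ContinuousOn f V := by
    have hc : Continuous fun v : ↥V => f v := by
      have : (fun v : ↥V => f v) = fun v => ((t v : EuclideanSpace ℝ (Fin k))) := funext fun v => (hft v).symm
      rw [this]
      exact continuous_subtype_val.comp t.continuous
    exact continuousOn_iff_continuous_restrict.2 hc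
  have hmaps : MapsTo (fun v : ↥V => f v) ({(⟨p, hp⟩ : ↥V)}ᶜ : Set ↥V) ({(0 : EuclideanSpace ℝ (Fin k))}ᶜ) := by
    intro v hv h0
    have h1 : t v = D.zero := Subtype.ext ((hft v).trans h0)
    exact ht hv h1
  -- left-hand side: the composite is `f|V`
  have lhs : J (relativeSingularHomology.map ℤ ℤ t ht k ((localHomology.openSubsetIso ℤ ℤ hV hp k).inv (g.localClass p))) =
      relativeSingularHomology.map ℤ ℤ (⟨fun v : ↥V => f v, hfc.restrict⟩ : C(↥V, EuclideanSpace ℝ (Fin k))) hmaps k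
        ((localHomology.openSubsetIso ℤ ℤ hV hp k).inv (g.localClass p)) := by
    have hcomp : (subsetIncl (closedBall (0 : EuclideanSpace ℝ (Fin k)) D.r)).comp t =
        (⟨fun v : ↥V => f v, hfc.restrict⟩ : C(↥V, EuclideanSpace ℝ (Fin k))) :=
      ContinuousMap.ext fun v => hft v
    rw [hJ, ← ModuleCat.comp_apply, ← relativeSingularHomology.map_comp,
      relativeSingularHomology.map_congr ℤ ℤ hcomp _ hmaps k]
  rw [lhs, hdeg hfc hmaps, map_zsmul, hJ, D.map_subsetIncl_modelBaseClass]

/-! ### The local piece at a crossing of local degree `d` -/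

variable [T2Space X]

/-- **The local piece at a crossing of local degree `d`** (Milnor 1965, proof of Lemma 6.3, PDF
p. 37, with Hatcher 2002, Prop. 2.30 / §3.3 p. 233 for the local degree).  Let `U ⊆ T` with
`φ(U) ⊆ N`, a Euclidean model `e : V ≃ U` (`V ⊆ ℝᵏ` open, `c ∈ V`) such that `K ∘ φ ∘ e = f` on
`V` for a map `f` of local degree `d` at `c` (`f⁎ g_c = d • g₀`), and such that `φ (e c) ∈ P` is
the only point of `φ(U)` on `P`.  Then pushing the transported local orientation class
`e⁎ g_c ∈ Hₖ(U | e c)` along `ret ∘ φ : (U, U ∖ e c) → (D, D ∖ m 0)` gives `d • w₀`.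
[cite: MilnorHCobordism1965, proof of Lemma 6.3 (PDF p. 37)] [cite: HatcherAT2002, Prop. 2.30 and §3.3 p. 233] -/
theorem map_ret_comp_xEquiv_localClass_smul (g : HomologicalOrientation ℤ (EuclideanSpace ℝ (Fin k)) k)
    {T : Type u} [TopologicalSpace T] (φ : C(T, X)) {U : Set T} (hUN : ∀ t ∈ U, φ t ∈ D.N)
    {V : Set (EuclideanSpace ℝ (Fin k))} (hV : IsOpen V) {c : EuclideanSpace ℝ (Fin k)} (hc : c ∈ V)
    (e : ↥V ≃ₜ ↥U) (f : EuclideanSpace ℝ (Fin k) → EuclideanSpace ℝ (Fin k))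
    (hf : ∀ v : ↥V, f v = D.K ⟨φ (e v), hUN _ (e v).2⟩)
    (d : ℤ)
    (hdeg : ∀ (hfc : ContinuousOn f V)
      (hm : MapsTo (fun v : ↥V => f v) ({(⟨c, hc⟩ : ↥V)}ᶜ : Set ↥V) ({(0 : EuclideanSpace ℝ (Fin k))}ᶜ)),
      relativeSingularHomology.map ℤ ℤ (⟨fun v : ↥V => f v, hfc.restrict⟩ : C(↥V, EuclideanSpace ℝ (Fin k)))
        hm k ((localHomology.openSubsetIso ℤ ℤ hV hc k).inv (g.localClass c)) = d • g.localClass 0)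
    (hφ : MapsTo (fun t : ↥U => (⟨φ t, hUN t t.2⟩ : ↥D.N)) ({e ⟨c, hc⟩}ᶜ : Set ↥U) (Subtype.val ⁻¹' D.Pᶜ)) :
    relativeSingularHomology.map ℤ ℤ
        (D.ret.comp ⟨fun t : ↥U => (⟨φ t, hUN t t.2⟩ : ↥D.N), by fun_prop⟩) (D.mapsTo_ret.comp hφ) k
        (localHomology.xEquiv ℤ ℤ e ⟨c, hc⟩ k ((localHomology.openSubsetIso ℤ ℤ hV hc k).inv (g.localClass c))) =
      d • D.baseClass g := by
  -- values of `f` in the ball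
  have hfr : ∀ v : ↥V, f v ∈ closedBall (0 : EuclideanSpace ℝ (Fin k)) D.r := fun v => by
    rw [hf v]; exact D.apply_mem_closedBall _
  -- the model map `t = f|V : V → B̄(0, r)` and the commuting square with `ret ∘ φ`
  have htc : Continuous fun v : ↥V => f v := by
    have : (fun v : ↥V => f v) = fun v => D.K ⟨φ (e v), hUN _ (e v).2⟩ := funext hf
    rw [this]
    exact D.K.continuous.comp (by fun_prop)
  let t : C(↥V, ↥(closedBall (0 : EuclideanSpace ℝ (Fin k)) D.r)) := ⟨fun v => ⟨f v, hfr v⟩, htc.subtype_mk _⟩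
  have ht : MapsTo t ({(⟨c, hc⟩ : ↥V)}ᶜ : Set ↥V) ({D.zero}ᶜ : Set _) := by
    intro v hv h0
    have h1 : f v = 0 := congrArg Subtype.val h0
    rw [hf v, D.eq_zero_iff] at h1
    have h2 : e v ∈ ({e ⟨c, hc⟩}ᶜ : Set ↥U) := fun h => hv (e.injective h)
    exact hφ h2 h1
  have hsq : ∀ v : ↥V, (D.ret.comp ⟨fun t : ↥U => (⟨φ t, hUN t t.2⟩ : ↥D.N), by fun_prop⟩) (e v) =
      D.discHomeomorph (t v) := fun v => by
    apply Subtype.ext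
    rw [D.coe_discHomeomorph]
    change D.m (D.K ⟨φ (e v), _⟩) = D.m (f v)
    rw [hf v]
  -- transport across universes
  have key := relativeSingularHomology.xEquiv_map ℤ ℤ e D.discHomeomorph t
    (D.ret.comp ⟨fun t : ↥U => (⟨φ t, hUN t t.2⟩ : ↥D.N), by fun_prop⟩) hsq
    (mapsTo_compl_singleton e.toEquiv ⟨c, hc⟩) (mapsTo_symm_compl_singleton e.toEquiv ⟨c, hc⟩)
    D.mapsTo_discHomeomorph D.mapsTo_discHomeomorph_symm ht (D.mapsTo_ret.comp hφ) k
    ((localHomology.openSubsetIso ℤ ℤ hV hc k).inv (g.localClass c))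
  change relativeSingularHomology.map ℤ ℤ _ _ k (relativeSingularHomology.xEquiv ℤ ℤ e _ _ k _) = _
  rw [← key, D.map_localClass_closedBall_eq_smul g hV hc t f (fun _ => rfl) d hdeg ht, map_zsmul]
  rfl

/-! ### The sum over the crossings -/

/-- **The sum over the crossings, with arbitrary local degrees** (Milnor 1965, proof of Lemma
6.3, PDF p. 37: `H_r(M) → H_r(M, M - M ∩ M') ≅ Σᵢ H_r(Uᵢ, Uᵢ - pᵢ) → …`, *"from which it follows
that `g([M]) = M' · M`"*, the sum of the local intersection numbers; Hatcher 2002, Prop. 2.30 for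
the local degrees).  Let `φ : T → X` be continuous (`T` a `T₁` space of the universe of `X`),
meeting `P` exactly in the finitely many points `vᵢ = φ(eᵢ cᵢ)` described by Euclidean models
`eᵢ : Vᵢ ≃ Uᵢ` (`Vᵢ ⊆ ℝᵏ` open, `cᵢ ∈ Vᵢ`, `Uᵢ` a neighbourhood of `vᵢ` in `T` containing no other
`v_l`, `φ(Uᵢ) ⊆ N`) on which the normal coordinate `K ∘ φ ∘ eᵢ = fᵢ` has local degree `dᵢ` at
`cᵢ` (`(fᵢ)⁎ g_{cᵢ} = dᵢ • g₀`).  If the local pieces of `σ ∈ Hₖ(T)` at the `vᵢ` are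
`aᵢ • (eᵢ)⁎ g_{cᵢ}`, then `Λ(j⁎ φ⁎ σ) = (Σᵢ aᵢ dᵢ) • w₀` in `Hₖ(D | m 0)`.
[cite: MilnorHCobordism1965, proof of Lemma 6.3 (PDF p. 37)] [cite: HatcherAT2002, Prop. 2.30, Thm. 2.20, §3.3 pp. 233–236] -/
theorem functional_ofAbsolute_map_eq_sum_smul (g : HomologicalOrientation ℤ (EuclideanSpace ℝ (Fin k)) k)
    {A : Set X} (hA : A ⊆ D.Pᶜ) {T : Type u} [TopologicalSpace T] [T1Space T] (φ : C(T, X))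
    {ι : Type*} [Fintype ι] {U : ι → Set T} (hUN : ∀ i, ∀ t ∈ U i, φ t ∈ D.N)
    {V : ι → Set (EuclideanSpace ℝ (Fin k))} (hV : ∀ i, IsOpen (V i))
    {c : ι → EuclideanSpace ℝ (Fin k)} (hc : ∀ i, c i ∈ V i) (e : ∀ i, ↥(V i) ≃ₜ ↥(U i))
    (hsep : ∀ i l, l ≠ i → ((e l ⟨c l, hc l⟩ : ↥(U l)) : T) ∉ U i)
    (hF : {t | φ t ∈ D.P} = ⋃ i ∈ (Finset.univ : Finset ι), {((e i ⟨c i, hc i⟩ : ↥(U i)) : T)})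
    (f : ι → EuclideanSpace ℝ (Fin k) → EuclideanSpace ℝ (Fin k))
    (hf : ∀ i (v : ↥(V i)), f i v = D.K ⟨φ (e i v), hUN i _ (e i v).2⟩)
    (d : ι → ℤ)
    (hdeg : ∀ i (hfc : ContinuousOn (f i) (V i))
      (hm : MapsTo (fun v : ↥(V i) => f i v) ({(⟨c i, hc i⟩ : ↥(V i))}ᶜ : Set ↥(V i))
        ({(0 : EuclideanSpace ℝ (Fin k))}ᶜ)),
      relativeSingularHomology.map ℤ ℤ (⟨fun v : ↥(V i) => f i v, hfc.restrict⟩ : C(↥(V i), EuclideanSpace ℝ (Fin k)))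
        hm k ((localHomology.openSubsetIso ℤ ℤ (hV i) (hc i) k).inv (g.localClass (c i))) = d i • g.localClass 0)
    (σ : singularHomology ℤ ℤ T k) (a : ι → ℤ)
    (hσ : ∀ i, relativeSingularHomology.map ℤ ℤ (subsetIncl (U i))
      (localHomology.mapsTo_subsetIncl_compl (e i ⟨c i, hc i⟩).2) k
        (a i • localHomology.xEquiv ℤ ℤ (e i) ⟨c i, hc i⟩ k
          ((localHomology.openSubsetIso ℤ ℤ (hV i) (hc i) k).inv (g.localClass (c i)))) =
      singularHomology.toLocal ℤ ℤ ((e i ⟨c i, hc i⟩ : ↥(U i)) : T) k σ) :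
    D.functional hA k ((singularHomology.map ℤ ℤ φ k ≫ relativeSingularHomology.ofAbsolute ℤ ℤ X A k) σ) =
      (∑ i, a i * d i) • D.baseClass g := by
  classical
  -- the crossing points and the set `F = φ⁻¹(P)`
  set v : ι → T := fun i => ((e i ⟨c i, hc i⟩ : ↥(U i)) : T) with hv
  have hvU : ∀ i, v i ∈ U i := fun i => (e i ⟨c i, hc i⟩).2
  have hvinj : Injective v := injective_pts hvU hsep
  set F : Set T := {t | φ t ∈ D.P} with hFdef
  have hφF : MapsTo φ Fᶜ D.Pᶜ := fun t ht h => ht h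
  -- Step 1: `loc (j⁎ φ⁎ σ) = φ⁎ z`, `z` the localisation of `σ` at `F`
  set z : localHomologyOfSet ℤ ℤ T F k := singularHomology.toLocalOfSet ℤ ℤ T F k σ with hz
  have h1 : D.loc hA k ((singularHomology.map ℤ ℤ φ k ≫ relativeSingularHomology.ofAbsolute ℤ ℤ X A k) σ) =
      relativeSingularHomology.map ℤ ℤ φ hφF k z := by
    have e1 : relativeSingularHomology.ofAbsolute ℤ ℤ X A k ≫ D.loc hA k =
        relativeSingularHomology.ofAbsolute ℤ ℤ X D.Pᶜ k := by
      rw [loc, relativeSingularHomology.ofAbsolute_comp_map, singularHomology.map_id, Category.id_comp]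
    have e2 : singularHomology.map ℤ ℤ φ k ≫ relativeSingularHomology.ofAbsolute ℤ ℤ X D.Pᶜ k =
        singularHomology.toLocalOfSet ℤ ℤ T F k ≫ relativeSingularHomology.map ℤ ℤ φ hφF k := by
      rw [singularHomology.toLocalOfSet, relativeSingularHomology.ofAbsolute_comp_map]
    rw [ModuleCat.comp_apply, ← ModuleCat.comp_apply (relativeSingularHomology.ofAbsolute ℤ ℤ X A k), e1,
      ← ModuleCat.comp_apply, e2, ModuleCat.comp_apply]
  -- Step 2: `z = Σᵢ (jᵢ)⁎ (aᵢ • Gᵢ)` (additivity of localisation)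
  have hw : ∀ i, relativeSingularHomology.map ℤ ℤ (subsetIncl (U i))
      (localHomology.mapsTo_subsetIncl_compl (hvU i)) k
        (a i • localHomology.xEquiv ℤ ℤ (e i) ⟨c i, hc i⟩ k
          ((localHomology.openSubsetIso ℤ ℤ (hV i) (hc i) k).inv (g.localClass (c i)))) =
      restrictLocal ℤ ℤ (localHomologyOfSet.singleton_subset_of_eq_biUnion_singleton hF i) k z := by
    intro i
    rw [hσ i, hz, singularHomology.restrictLocal_toLocalOfSet]
    rfl
  have h2 := localHomologyOfSet.eq_sum_of_forall_map_eq_restrictLocal ℤ ℤ hvinj hvU hsep hF k z _ hw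
  -- Step 3: push each term: `exc⁻¹ ∘ φ⁎ ∘ (jᵢ)⁎ = (φᵢ)⁎`, `φᵢ : Uᵢ → N`, then `ret⁎`
  have hφi : ∀ i, MapsTo (fun t : ↥(U i) => (⟨φ t, hUN i t t.2⟩ : ↥D.N)) ({e i ⟨c i, hc i⟩}ᶜ : Set ↥(U i))
      (Subtype.val ⁻¹' D.Pᶜ) := by
    intro i t ht htP
    have htF : (t : T) ∈ F := htP
    rw [hF] at htF
    obtain ⟨l, -, hl⟩ : ∃ l, l ∈ (Finset.univ : Finset ι) ∧ (t : T) = ((e l ⟨c l, hc l⟩ : ↥(U l)) : T) := by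
      simpa only [mem_iUnion, mem_singleton_iff, exists_prop] using htF
    by_cases hli : l = i
    · subst hli
      exact ht (Subtype.ext hl)
    · exact hsep i l hli (hl ▸ t.2)
  have h4 : ∀ i (y : relativeSingularHomology ℤ ℤ ↥(U i) ({e i ⟨c i, hc i⟩}ᶜ : Set ↥(U i)) k),
      (inv (D.exc k) ≫ relativeSingularHomology.map ℤ ℤ D.ret D.mapsTo_ret k)
        (relativeSingularHomology.map ℤ ℤ φ hφF k
          (relativeSingularHomology.map ℤ ℤ (subsetIncl (U i))
            (localHomologyOfSet.mapsTo_subsetIncl_compl_of_forall_notMem hF hvU hsep i) k y)) =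
      relativeSingularHomology.map ℤ ℤ
        (D.ret.comp ⟨fun t : ↥(U i) => (⟨φ t, hUN i t t.2⟩ : ↥D.N), by fun_prop⟩)
        (D.mapsTo_ret.comp (hφi i)) k y := by
    intro i y
    have e1 : relativeSingularHomology.map ℤ ℤ (subsetIncl (U i))
          (localHomologyOfSet.mapsTo_subsetIncl_compl_of_forall_notMem hF hvU hsep i) k ≫
        relativeSingularHomology.map ℤ ℤ φ hφF k =
        relativeSingularHomology.map ℤ ℤ
          (⟨fun t : ↥(U i) => (⟨φ t, hUN i t t.2⟩ : ↥D.N), by fun_prop⟩ : C(↥(U i), ↥D.N)) (hφi i) k ≫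
          D.exc k := by
      rw [exc, ← relativeSingularHomology.map_comp, ← relativeSingularHomology.map_comp]
      rfl
    have e2 := congrArg (fun ψ' => (inv (D.exc k) ≫ relativeSingularHomology.map ℤ ℤ D.ret D.mapsTo_ret k) (ψ' y)) e1
    simp only [ModuleCat.comp_apply] at e2 ⊢
    rw [e2, ← ModuleCat.comp_apply (D.exc k) (inv (D.exc k)), IsIso.hom_inv_id, ModuleCat.id_apply,
      ← ModuleCat.comp_apply, ← relativeSingularHomology.map_comp]
  -- assemble
  have e0 : D.functional hA k ((singularHomology.map ℤ ℤ φ k ≫ relativeSingularHomology.ofAbsolute ℤ ℤ X A k) σ) =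
      (inv (D.exc k) ≫ relativeSingularHomology.map ℤ ℤ D.ret D.mapsTo_ret k)
        (D.loc hA k ((singularHomology.map ℤ ℤ φ k ≫ relativeSingularHomology.ofAbsolute ℤ ℤ X A k) σ)) := by
    rw [functional]; rfl
  rw [e0, h1, h2, map_sum, map_sum]
  rw [Finset.sum_congr rfl (fun i _ => by
    rw [h4 i, map_zsmul, D.map_ret_comp_xEquiv_localClass_smul g φ (hUN i) (hV i) (hc i) (e i) (f i) (hf i)
      (d i) (hdeg i) (hφi i), smul_smul])]
  exact (sum_zsmul_eq _ _ _).symm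

end TransverseDiscDatum

end Literature.AlgebraicTopology.SingularHomology

end
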